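import Summits.QuantumFields.YangMills.Theorems.BalabanUVNodesN21AtSRec12Weight
import Summits.QuantumFields.YangMills.Theorems.BalabanUVNodesN21SelectedThresholds

/-!
# YM-DAG node N21 (= NE7c) — THE N21 SLOT OF K3′'s COMPOSITE AT THE STAGE-12 HOMES ON THE SELECTION ROAD: supplied by a THRESHOLD-PARAMETRIC SHARP OBJECT READ AT
# A SELECTED ADMISSIBLE ASSIGNMENT (module 18b, ROW A″) through module 9's ∃-weight currency — (M1) PROVED at the selected thresholds, carriers SHARP (no window average)

Track A of `YM-PLAN.md` (cell `pub-ymgap`, HUMAN RULING D-0062), node **N21**; R134 fan-out seat `pub-ymgap-dag-n21-d` (s2 = BY-NAME KNIT at the record), generation 4, module 19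
(the selection-road twin of module 13 `BalabanUVNodesN21AtSRec12Mixture`, p475193).  THEOREMS ONLY: 0 `def`, 0 `sorry`, standard axioms; COUNT-NEUTRAL; `--supports` the K3′
item `SpineGivenEndpointR12` (stmt-QuantumFields-19908) as a helper.  `N`-generic, NO Theses import (restate-immune).  Imports module 9 `BalabanUVNodesN21AtSRec12Weight`
(p469219: `spine_rec12C_of_homes₁₂_existsShellWeight` over dag-n27-c XXVII) and module 18b `BalabanUVNodesN21SelectedThresholds` (p485209: `levelLedger_of_goodAssignment`,
`levelConst_le`).  Restates nothing; cites by name.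

WHAT IS PROVED ([bookkeeping]).
* §1 `levelLedgers_shellWeightBound_keyed₁₂_of_selectedSharp` — for a spine reading `cr` whose carriers ARE, at every admissible Stage-12 tuple with provisos and every `(g₀, os)`,
  a threshold-parametric sharp object READ AT an admissible assignment `a` carrying the SELECTION CERTIFICATE (every slot of either run satisfies (M1) at its level's selected
  threshold — what module 18b's `exists_goodAssignment` supplies), with the (R) facts and the two pushes (losses `M₁`, `M₂`) at `a`, N20's live windows, `κ_min`, `ρ_j ≤ ½` and
  N16's rate (`hsel`): the carriers THEMSELVES carry road I's two `LevelLedger`s (at SHARP letters; (M1) proved at the selected thresholds) and `ShellWeightBound (cr F θ hP g₀ os) …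
  (K ↦ C·ϑ^K)` — module 18b's `levelLedger_of_goodAssignment` ×2 + n21-a's `n21_knit_levels_geometric`.
* §2 (docstring only): dag-n27-c XXVII's composite with the N21 slot on the selection road is ONE application of module 9's `spine_rec12C_of_homes₁₂_existsShellWeight`
  fed by §1 (the statement would coincide with module 13's up to the Prop package, so it is not re-declared — gate dedup rule).

HONEST FRAMING (binding).  `hsel` = NODE O's threshold-parametric sharp term object at ₁₂ READ AT SELECTED THRESHOLDS + the pushes against older-measurable t-free dominating
laws ((R) + (PD) ∕ mass control — E-class) + admissibility ((L1-step) ∕ U2) + N20's windows + N16's rate — HYPOTHESES, displayed; the selection certificate is a THEOREM for any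
such object (18b `exists_goodAssignment`) but the object itself is nobody's today; every K4 ∕ K5 stub and the edge are HYPOTHESES; `cr`, `𝔯` PARAMETERS; no inhabitant of
`IsDatumOfRecord₁₂C` claimed (K0′ open); nothing of Bałaban's asserted; NE7c NOT PRINTED ∕ NOT PROVED; **N21 NOT discharged**, N27 NOT discharged, K3′ NOT claimed; typed 28∕28,
discharged count untouched; one finite four-torus programme at fixed `ε` — NOT ℝ⁴, NOT infinite volume, NOT OS, NOT a mass gap, NOT Clay.  No decl below carries a cite tag.
-/

set_option autoImplicit false

noncomputable section

open scoped BigOperators ENNReal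
open MeasureTheory Set

namespace Summit.QuantumFields.YangMills.Theorems.N21AtSRec12Selected

open Literature.MathematicalPhysics.QuantumFieldTheory.Balaban1983to89
open Literature.MathematicalPhysics.QuantumFieldTheory.Balaban1983to89.T4Continuum (T4Family ULoop)
open Literature.MathematicalPhysics.QuantumFieldTheory.Balaban1983to89.T4ShellMeasure (SlotAntiConcentration)
open T4IndicatorShell (ShellWeightBound)
open T4ShellMeasureLevels (LevelLedger LiveWindow)
open Summit.QuantumFields.BalabanUV.T4Continuum.Spine
open YMDAG.UVSplit
open Node00 (Stage12Params datumOfRecord₁₂ IsRecordOfRecord₁₂C IsDatumOfRecord₁₂C)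
open N21SelectedThresholds (levelLedger_of_goodAssignment levelConst_le)

variable {N : ℕ} [NeZero N] (cr : SpineReading₁₂ N)
  (hsel : ∀ (F : T4Family) (θ : Stage12Params F N) (hP : θ.Provisos₁₂ F N), θ.Admissible F N → ∀ (g₀ : ℕ → ℝ) (os : List (ULoop F)),
      ∃ (σ : Type) (_dσ : DecidableEq σ) (X : ℕ → σ → Type) (_m : ∀ K s, MeasurableSpace (X K s))
        (SA SB : ℕ → Finset σ) (lvl : ℕ → σ → ℕ)
        (ν : ∀ K : ℕ, (ℕ → ℝ) → ∀ s : σ, Measure (X K s)) (_f : ∀ K a s, IsFiniteMeasure (ν K a s))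
        (w : ∀ (K : ℕ) (s : σ), X K s → ℝ) (θw κ ρ : ℕ → ℝ) (Fbar : ℝ) (D' : ℕ → ℝ)
        (A shA B shB : ℕ → (ℕ → ℝ) → ℝ → (cr F θ hP g₀ os).ι → ℝ) (pieceA pieceB : ℕ → (ℕ → ℝ) → ℝ → σ → (cr F θ hP g₀ os).ι → ℝ) (M₁ M₂ : ℝ)
        (N₁ : ℕ) (νbar κmin c₁ ϑ : ℝ) (a : ℕ → ℕ → ℝ),
        -- signs, windows, widths, the level constant
        (∀ j, 0 ≤ ρ j) ∧ 0 ≤ M₁ ∧ 0 < M₂ ∧ (∀ j, D' j = Fbar / ((1 - ρ j) * κ j)) ∧ 0 ≤ Fbar ∧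
        0 < κmin ∧ (∀ j, κmin ≤ κ j) ∧ (∀ j, ρ j ≤ 1 / 2) ∧
        -- the admissible assignment and its selection certificate (both runs' slots)
        (∀ K j, a K j ∈ Icc ((1 - κ j) * θw j) (θw j)) ∧
        (∀ K, ∀ s ∈ SA K ∪ SB K, SlotAntiConcentration (ν K (a K) s) (w K s) (a K (lvl K s)) (ρ (lvl K s)) (D' (lvl K s))) ∧
        -- the carriers ARE the sharp object read at `a`
        ((cr F θ hP g₀ os).A = fun K => A K (a K)) ∧ ((cr F θ hP g₀ os).shA = fun K => shA K (a K)) ∧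
        ((cr F θ hP g₀ os).B = fun K => B K (a K)) ∧ ((cr F θ hP g₀ os).shB = fun K => shB K (a K)) ∧
        -- run A at `a`: (R) and the two pushes
        (∀ K t, |t| ≤ (cr F θ hP g₀ os).l₀ → ∀ τ ∈ (cr F θ hP g₀ os).T K, 0 ≤ shA K (a K) t τ ∧ shA K (a K) t τ ≤ A K (a K) t τ ∧
          shA K (a K) t τ ≤ ∑ s ∈ SA K, pieceA K (a K) t s τ) ∧
        (∀ K t, |t| ≤ (cr F θ hP g₀ os).l₀ → ∀ s ∈ SA K, ∑ τ ∈ (cr F θ hP g₀ os).T K, pieceA K (a K) t s τ ≤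
          M₁ * (ν K (a K) s {x | a K (lvl K s) * (1 - ρ (lvl K s)) ≤ w K s x ∧ w K s x < a K (lvl K s)}).toReal) ∧
        (∀ K t, |t| ≤ (cr F θ hP g₀ os).l₀ → ∀ s ∈ SA K, M₂ * (ν K (a K) s univ).toReal ≤ ∑ τ ∈ (cr F θ hP g₀ os).T K, A K (a K) t τ) ∧
        -- run B at `a`
        (∀ K t, |t| ≤ (cr F θ hP g₀ os).l₀ → ∀ τ ∈ (cr F θ hP g₀ os).T K, 0 ≤ shB K (a K) t τ ∧ shB K (a K) t τ ≤ B K (a K) t τ ∧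
          shB K (a K) t τ ≤ ∑ s ∈ SB K, pieceB K (a K) t s τ) ∧
        (∀ K t, |t| ≤ (cr F θ hP g₀ os).l₀ → ∀ s ∈ SB K, ∑ τ ∈ (cr F θ hP g₀ os).T K, pieceB K (a K) t s τ ≤
          M₁ * (ν K (a K) s {x | a K (lvl K s) * (1 - ρ (lvl K s)) ≤ w K s x ∧ w K s x < a K (lvl K s)}).toReal) ∧
        (∀ K t, |t| ≤ (cr F θ hP g₀ os).l₀ → ∀ s ∈ SB K, M₂ * (ν K (a K) s univ).toReal ≤ ∑ τ ∈ (cr F θ hP g₀ os).T K, B K (a K) t τ) ∧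
        -- windows (N20), rate (N16)
        LiveWindow SA lvl N₁ νbar ∧ LiveWindow SB lvl N₁ νbar ∧ 0 < ϑ ∧ ϑ < 1 ∧ 0 ≤ c₁ ∧ (∀ j, ρ j ≤ c₁ * ϑ ^ j))

include hsel

/-! ## §1 NE7c at the reading's carriers with an explicit geometric weight, from selected sharp data -/

/-- **THE K5 FACE OF N21 ON THE SELECTION ROAD — BOTH LEVEL LEDGERS AT THE SHARP CARRIERS AND A GEOMETRIC SHELL WEIGHT, AT EVERY ADMISSIBLE STAGE-12 TUPLE.**
For a spine reading `cr` whose carriers are, at every admissible tuple with provisos and every `(g₀, os)`, a threshold-parametric sharp object read at a selected admissible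
assignment with its certificate (`hsel`; NO clause on the weight slot): the carriers THEMSELVES carry road I's two `LevelLedger`s (slot families, levels, per-slot pieces, level
constants `D_j = M₁∕M₂·F̄∕((1−ρ_j)κ_j)` — (M1) PROVED at the selected thresholds, module 18b's `levelLedger_of_goodAssignment` for each run) AND `ShellWeightBound (cr F θ hP g₀ os) …
(K ↦ C·ϑ^K)` with `0 < ϑ < 1`, `0 ≤ C` (`levelConst_le` + n21-a's `n21_knit_levels_geometric` at `D̄ = M₁∕M₂·2F̄∕κ_min`, `C = 2((N₁+1)ν̄D̄c₁ϑ^{−N₁})`).  On the mixture road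
(module 13) the ledgers live on window-AVERAGED carriers; here they live on the SHARP ones.  CONDITIONAL on every displayed binder; NE7c NOT proved; N21 NOT discharged.
[bookkeeping] -/
theorem levelLedgers_shellWeightBound_keyed₁₂_of_selectedSharp (F : T4Family) (θ : Stage12Params F N) (hP : θ.Provisos₁₂ F N) (hθ : θ.Admissible F N)
    (g₀ : ℕ → ℝ) (os : List (ULoop F)) :
    ∃ (σ : Type) (SA SB : ℕ → Finset σ) (lvl : ℕ → σ → ℕ) (pieceA pieceB : ℕ → ℝ → σ → (cr F θ hP g₀ os).ι → ℝ) (D ρ : ℕ → ℝ) (ϑ C : ℝ),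
      LevelLedger (cr F θ hP g₀ os).l₀ (cr F θ hP g₀ os).T (cr F θ hP g₀ os).A (cr F θ hP g₀ os).shA SA pieceA lvl D ρ ∧
      LevelLedger (cr F θ hP g₀ os).l₀ (cr F θ hP g₀ os).T (cr F θ hP g₀ os).B (cr F θ hP g₀ os).shB SB pieceB lvl D ρ ∧
      0 < ϑ ∧ ϑ < 1 ∧ 0 ≤ C ∧ ShellWeightBound (cr F θ hP g₀ os).l₀ (cr F θ hP g₀ os).T (cr F θ hP g₀ os).A (cr F θ hP g₀ os).B
        (cr F θ hP g₀ os).shA (cr F θ hP g₀ os).shB fun K => C * ϑ ^ K := by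
  obtain ⟨σ, _dσ, X, _m, SA, SB, lvl, ν, _f, w, θw, κ, ρ, Fbar, D', A, shA, B, shB, pieceA, pieceB, M₁, M₂, N₁, νbar, κmin, c₁, ϑ, a,
    hρ0, hM₁, hM₂, hD', hFbar, hκmin, hκminle, hρhalf, _hadm, hgood, hSA, hSshA, hSB, hSshB, hRA, hpushA, htotalA, hRB, hpushB, htotalB,
    hwinA, hwinB, hϑ0, hϑ1, hc₁, hrate⟩ := hsel F θ hP hθ g₀ os
  have hD'0 : ∀ j, 0 ≤ D' j := fun j => by
    rw [hD' j]
    have h1 : 0 < 1 - ρ j := by linarith [hρhalf j]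
    have h2 : 0 < κ j := lt_of_lt_of_le hκmin (hκminle j)
    positivity
  have hLA := levelLedger_of_goodAssignment (l₀ := (cr F θ hP g₀ os).l₀) (T := (cr F θ hP g₀ os).T) a
    (fun K s hs => hgood K s (Finset.mem_union_left _ hs)) hD'0 hρ0 hM₁ hM₂
    (fun K t ht τ hτ => (hRA K t ht τ hτ).1) (fun K t ht τ hτ => (hRA K t ht τ hτ).2.1) (fun K t ht τ hτ => (hRA K t ht τ hτ).2.2)
    hpushA htotalA
  have hLB := levelLedger_of_goodAssignment (l₀ := (cr F θ hP g₀ os).l₀) (T := (cr F θ hP g₀ os).T) a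
    (fun K s hs => hgood K s (Finset.mem_union_right _ hs)) hD'0 hρ0 hM₁ hM₂
    (fun K t ht τ hτ => (hRB K t ht τ hτ).1) (fun K t ht τ hτ => (hRB K t ht τ hτ).2.1) (fun K t ht τ hτ => (hRB K t ht τ hτ).2.2)
    hpushB htotalB
  have hD : ∀ j, M₁ / M₂ * D' j ≤ M₁ / M₂ * (2 * Fbar / κmin) := fun j => by
    rw [hD' j]
    exact mul_le_mul_of_nonneg_left (levelConst_le hFbar (hρhalf j) hκmin (hκminle j)) (div_nonneg hM₁ hM₂.le)
  have hν : 0 ≤ νbar := hwinA.νbar_nonneg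
  have hSW := n21_knit_levels_geometric hLA hLB hwinA hwinB hD hD hϑ0 hϑ1 hrate hrate
  have hC : 0 ≤ 2 * ((N₁ + 1) * νbar * (M₁ / M₂ * (2 * Fbar / κmin)) * c₁ * ϑ⁻¹ ^ N₁) := by
    have : 0 ≤ M₁ / M₂ * (2 * Fbar / κmin) := by positivity
    positivity
  rw [hSA, hSshA, hSB, hSshB]
  exact ⟨σ, SA, SB, lvl, _, _, _, ρ, ϑ, _, hLA, hLB, hϑ0, hϑ1, hC, hSW⟩

/-! ## §2 The composite at the homes on the selection road is ONE application away

dag-n27-c XXVII's composite with the N21 slot on the selection road is `N21AtSRec12Weight.spine_rec12C_of_homes₁₂_existsShellWeight cr 𝔯 h14 h15 h16 h17 h18 h22 hx' h20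
(fun F θ hP hθ g₀ os => by obtain ⟨_, _, _, _, _, _, _, _, ϑ, C, _, _, _, _, _, hSW⟩ := levelLedgers_shellWeightBound_keyed₁₂_of_selectedSharp cr hsel F θ hP hθ g₀ os;
exact ⟨_, hSW⟩) h19` — its statement coincides binder for binder with module 13's `spine_rec12C_of_homes₁₂_sharpPushMixture` up to the Prop package (`hsel` for `hmix`),
so it is not re-declared here (gate dedup rule); consumers write the line above. -/

end Summit.QuantumFields.YangMills.Theorems.N21AtSRec12Selected

end
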